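import Mathlib.Tactic
import Summits.CriticalPhenomena.PercolationContinuityZ3.Theorems.Transplant.SkelFrmBChoiceRegionsYCore
import HarnessLib

/-!
# N2 (frames-only node `SamePDropOfSkeletonFrm₁`, OPEN) — (ζ″) ledger: THE PURE-INTEGER CORE OF THE y′-CORRIDOR's PER-REGION READING ROWS
# (`NegB.drift_terms_le`, `NegB.regionY_core3`), instantiated region by region in `SkelFrmBChoiceRegionsYW`

p5-g16's `HY` per-region row `hPR` asks, for every region `k` of the second-axis schedule `kgCorrSchedY`, a frame box `[lo, hi] ⊇ region k` whose fine
readings satisfy `−5r₁ + 1 ≤ rdLo₁`, `rdHi₁ ≤ 22r₁ − 1` (along, axis 1) and `−2r₀ + 1 ≤ rdLo₀`, `rdHi₀ ≤ 2r₀ − 1` (across, axis 0).  The regions are the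
drift-following boxes of SkelPhiCorridorKGYRegions (run `k ≤ N`: centre `(k·v, k·sL)`; parkings: centre `((N+1)v, (N+1)sL)`); this file is the
slot-free arithmetic: such a box (columns `κv ± 66n`, rows `κσ + [−26σ, 2κ + 26σ]`) meets the four criteria premises of SkelPhiNegReachReadBK.
builds on p205010 (kernel theorem, internal audit signed; external expert review pending) — nothing here uses p205010; NOTHING is claimed about the open node `SamePDropOfSkeletonFrm₁`.
Lane `prim-bschramm`, seat `prim-bschramm-stmt` (gen 21); helper file (`--supports stmt-CriticalPhenomena-4575 --as helper`).
[cite: KozmaNitzan2024, §4 Lemma 11 (p. 22: the slabs of Ω), Lemma 12 (pp. 23–25)] [cite: MartineauTassion2017, §4.3 Lemma 4.2]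
-/

namespace Summit.CriticalPhenomena.PercolationContinuityZ3.Theorems.Transplant

namespace PlanarSkeletonFrm

namespace NegB

/-- **The pure-integer core of the per-region reading rows** (y′-corridor): a region box following the drift — columns `κv ± 66n`, rows
`κσ + [−BY, 2κ + BY]`, `BY ≤ 26σ`, `0 ≤ κ ≤ 21K + 3` (`K = 40kq`), `U·σ ≤ Δ ≤ U·σ + 2U`, `σ ≥ 958`, `kq ≥ 2` — satisfies the four premises of the
reading criteria `rdLo_one_geK/rdHi_one_leK/rdLo_zero_geK/rdHi_zero_leK` (SkelPhiNegReachReadBK) for the rows `[−5r₁+1, 22r₁−1] × [−2r₀+1, 2r₀−1]`,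
`r_i = 40kq·s_i`: along, `U·row/Δ ∈ [−15, 21K+19]·(1+ε)`; across, the drift `κv(Δ − Uσ) ∈ ±2κnU` is absorbed since `958·U ≤ Δ`. [folklore] -/
theorem regionY_core3 {U Δ σ n v kq s₀ s₁ r₀ r₁ κ BY lo0 hi0 lo1 hi1 : ℤ}
    (hU : 1 ≤ U) (hσ : 958 ≤ σ) (hUs : U * σ ≤ Δ) (hΔU : Δ ≤ U * σ + 2 * U) (hn : 1 ≤ n) (hv : |v| ≤ n) (hkq : 5 ≤ kq)
    (hs0 : 1 ≤ s₀) (hs1 : 1 ≤ s₁) (hr0 : r₀ = 40 * kq * s₀) (hr1 : r₁ = 40 * kq * s₁)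
    (hκ0 : 0 ≤ κ) (hκ : κ ≤ 840 * kq + 3) (hBY0 : 0 ≤ BY) (hBY : BY ≤ 26 * σ)
    (hlo0 : κ * v - 150 * n ≤ lo0) (hhi0 : hi0 ≤ κ * v + 150 * n)
    (hlo1 : κ * σ - BY ≤ lo1) (hlh : lo1 ≤ hi1) (hhi1 : hi1 ≤ κ * σ + 2 * κ + BY) :
    40 * kq * Δ * (-(5 * r₁) + 1) ≤ r₁ * (U * lo1) ∧
    r₁ * (U * hi1 + U - 1) < 40 * kq * Δ * (22 * r₁ - 1) ∧
    40 * kq * Δ * (n * (-(2 * r₀) + 1)) + r₀ * n ≤ r₀ * (Δ * lo0 - max (v * (U * lo1)) (v * (U * hi1 + U - 1))) ∧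
    r₀ * (Δ * hi0 - min (v * (U * lo1)) (v * (U * hi1 + U - 1))) < 40 * kq * Δ * (n * (2 * r₀ - 1)) := by
  have hU0 : 0 < U := by linarith
  have hU958 : 958 * U ≤ Δ := by have := mul_le_mul_of_nonneg_left hσ hU0.le; linarith
  have hΔ0 : 0 < Δ := by linarith
  have hn0 : 0 < n := by linarith
  have hkq0 : 0 < kq := by linarith
  have hkq2 : 2 ≤ kq := by linarith
  have h40 : (0 : ℤ) < 40 * kq := by linarith
  have hnΔ : 0 ≤ n * Δ := by positivity
  have hnU : 0 ≤ n * U := by positivity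
  have hkqΔ0 : 0 ≤ kq * Δ := by positivity
  obtain ⟨hM, hm⟩ := drift_terms_le (v := v) hU hv hκ0 hBY0 hlo1 hlh hhi1
  -- shared linear facts
  have hUBY : U * BY ≤ 26 * Δ := by have := mul_le_mul_of_nonneg_left hBY hU0.le; linarith
  have hκσ : 0 ≤ κ * σ := by positivity
  have hd0 : 0 ≤ Δ - U * σ := by linarith
  have hd1 : Δ - U * σ ≤ 2 * U := by linarith
  have hκv : |κ * v * (Δ - U * σ)| ≤ κ * n * (2 * U) := by
    rw [abs_mul, abs_mul, abs_of_nonneg hκ0, abs_of_nonneg hd0]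
    exact mul_le_mul (mul_le_mul_of_nonneg_left hv hκ0) hd1 hd0 (by positivity)
  have hκv' := abs_le.1 hκv
  have hκnU : κ * (n * U) ≤ (840 * kq + 3) * (n * U) := mul_le_mul_of_nonneg_right hκ hnU
  have hBYnU : (n * U) * BY ≤ (n * U) * (26 * σ) := mul_le_mul_of_nonneg_left hBY hnU
  have hnUσ : n * (U * σ) ≤ n * Δ := mul_le_mul_of_nonneg_left hUs hn0.le
  have hkqnU : 958 * (kq * (n * U)) ≤ kq * (n * Δ) := by
    have := mul_le_mul_of_nonneg_left hU958 hn0.le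
    have := mul_le_mul_of_nonneg_left (show n * (958 * U) ≤ n * Δ from this) hkq0.le
    linarith
  have hnU958 : 958 * (n * U) ≤ n * Δ := by have := mul_le_mul_of_nonneg_left hU958 hn0.le; linarith
  have hkqs1 : 2 * s₁ ≤ kq * s₁ := mul_le_mul_of_nonneg_right hkq2 (by linarith)
  have hkqs0 : 2 * s₀ ≤ kq * s₀ := mul_le_mul_of_nonneg_right hkq2 (by linarith)
  have hkqnΔ : 5 * (n * Δ) ≤ kq * (n * Δ) := mul_le_mul_of_nonneg_right hkq hnΔ
  refine ⟨?_, ?_, ?_, ?_⟩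
  · -- C1
    have hl : U * (κ * σ - BY) ≤ U * lo1 := mul_le_mul_of_nonneg_left hlo1 hU0.le
    have hκσU : 0 ≤ U * (κ * σ) := mul_nonneg hU0.le hκσ
    have hl' : -(26 * Δ) ≤ U * lo1 := by linarith
    have hs : s₁ * (-(26 * Δ)) ≤ s₁ * (U * lo1) := mul_le_mul_of_nonneg_left hl' (by linarith)
    have hpos : 0 ≤ Δ * (200 * (kq * s₁) - 26 * s₁ - 1) := mul_nonneg hΔ0.le (by linarith)
    have key : Δ * (-(200 * kq * s₁) + 1) ≤ s₁ * (U * lo1) := by linarith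
    have e1 : 40 * kq * Δ * (-(5 * r₁) + 1) = (40 * kq) * (Δ * (-(200 * kq * s₁) + 1)) := by rw [hr1]; ring
    have e2 : r₁ * (U * lo1) = (40 * kq) * (s₁ * (U * lo1)) := by rw [hr1]; ring
    rw [e1, e2]
    exact mul_le_mul_of_nonneg_left key h40.le
  · -- C2
    have hh : U * hi1 ≤ U * (κ * σ + 2 * κ + BY) := mul_le_mul_of_nonneg_left hhi1 hU0.le
    have hκΔ : κ * Δ ≤ (840 * kq + 3) * Δ := mul_le_mul_of_nonneg_right hκ hΔ0.le
    have hκU : κ * U ≤ (840 * kq + 3) * U := mul_le_mul_of_nonneg_right hκ hU0.le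
    have hκUσ : κ * (U * σ) ≤ κ * Δ := mul_le_mul_of_nonneg_left hUs hκ0
    have hkqU : 958 * (kq * U) ≤ kq * Δ := by have := mul_le_mul_of_nonneg_left hU958 hkq0.le; linarith
    have hT : U * hi1 + U - 1 ≤ (842 * kq + 30) * Δ := by linarith
    have hsT : s₁ * (U * hi1 + U - 1) ≤ s₁ * ((842 * kq + 30) * Δ) := mul_le_mul_of_nonneg_left hT (by linarith)
    have hpos : 0 < Δ * (38 * (kq * s₁) - 30 * s₁ - 1) := mul_pos hΔ0 (by linarith)
    have key : s₁ * (U * hi1 + U - 1) < Δ * (880 * kq * s₁ - 1) := by linarith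
    have e1 : r₁ * (U * hi1 + U - 1) = (40 * kq) * (s₁ * (U * hi1 + U - 1)) := by rw [hr1]; ring
    have e2 : 40 * kq * Δ * (22 * r₁ - 1) = (40 * kq) * (Δ * (880 * kq * s₁ - 1)) := by rw [hr1]; ring
    rw [e1, e2]
    exact mul_lt_mul_of_pos_left key h40
  · -- C3
    set M := max (v * (U * lo1)) (v * (U * hi1 + U - 1)) with hMdef
    have hloΔ : Δ * (κ * v - 150 * n) ≤ Δ * lo0 := mul_le_mul_of_nonneg_left hlo0 hΔ0.le
    have hnle : n ≤ n * Δ := le_mul_of_one_le_right hn0.le (by linarith)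
    have hZ1 : Δ * n ≤ (Δ * lo0 - M) + 80 * kq * (Δ * n) - n := by linarith
    have hsZ := mul_le_mul_of_nonneg_left hZ1 (by linarith : (0 : ℤ) ≤ s₀)
    have hΔn1 : Δ * n ≤ s₀ * (Δ * n) := le_mul_of_one_le_left (by positivity) hs0
    have e1 : 40 * kq * Δ * (n * (-(2 * r₀) + 1)) + r₀ * n = (40 * kq) * (Δ * n * (-(80 * kq * s₀) + 1) + s₀ * n) := by rw [hr0]; ring
    have e2 : r₀ * (Δ * lo0 - M) = (40 * kq) * (s₀ * (Δ * lo0 - M)) := by rw [hr0]; ring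
    rw [e1, e2]
    refine mul_le_mul_of_nonneg_left ?_ h40.le
    linarith
  · -- C4
    set Mm := min (v * (U * lo1)) (v * (U * hi1 + U - 1)) with hMmdef
    have hhiΔ : Δ * hi0 ≤ Δ * (κ * v + 150 * n) := mul_le_mul_of_nonneg_left hhi0 hΔ0.le
    have hnle : n ≤ n * Δ := le_mul_of_one_le_right hn0.le (by linarith)
    have hZ2 : Δ * n + 1 ≤ 80 * kq * (Δ * n) - (Δ * hi0 - Mm) := by linarith
    have hsZ := mul_le_mul_of_nonneg_left hZ2 (by linarith : (0 : ℤ) ≤ s₀)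
    have hΔn1 : Δ * n + 1 ≤ s₀ * (Δ * n + 1) := le_mul_of_one_le_left (by positivity) hs0
    have e1 : r₀ * (Δ * hi0 - Mm) = (40 * kq) * (s₀ * (Δ * hi0 - Mm)) := by rw [hr0]; ring
    have e2 : 40 * kq * Δ * (n * (2 * r₀ - 1)) = (40 * kq) * (Δ * n * (80 * kq * s₀ - 1)) := by rw [hr0]; ring
    rw [e1, e2]
    refine mul_lt_mul_of_pos_left ?_ h40
    linarith

end NegB

end PlanarSkeletonFrm

end Summit.CriticalPhenomena.PercolationContinuityZ3.Theorems.Transplant
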